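import Summits.MatrixMultiplication.MatrixMultiplication.Theorems.FarEdgeDescentTwistImageCore
import Mathlib.LinearAlgebra.Matrix.ToLinearEquiv
import Mathlib.Algebra.MvPolynomial.Funext
import HarnessLib

/-!
# The image class of the transpose twist: `𝔖^ᵀ ⋭ ⟨2,2,2⟩`

Route `FarEdgeDescent` (cell `decomp-mm`, lens 2 «structural dichotomy (special vs generic)»,
gen 32), Kernel VIII part 2; support for the aside `SubLogRate` (stmt-MatrixMultiplication-25371).

`FarEdgeDescentTwistRigidity` proved `⟨n,n,2L⟩^{⊠N} ⋭ 𝔖_φ^{⊠N}` for every non-product twist `φ`,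
and `FarEdgeDescentSignTwistDet` the converse non-degeneration `𝔖^♭, 𝔖^♭ᵀ ⋭ ⟨2,2,2⟩` (single copy,
`char ≠ 2`) from the DETERMINANT CLASS of a slice. For the transpose twist `𝔖^ᵀ = 𝔖_2(1)`
(`twistedStar`) the determinant class gives nothing (`det S = det Y · det Yᵀ = det²`, the same as
for `⟨2,2,2⟩`), and the quantum functionals agree as well. Here the converse
`𝔖^ᵀ ⋭ ⟨2,2,2⟩` (single copy, every infinite field) is proved from the IMAGE CLASS of the slice:

* the `y`-slices of `𝔖^ᵀ` are `S(y) = diag(Y, Yᵀ)`; for `Y = w₁ w₂ᵀ` of rank one, `S(y)` has rank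
  two and its image contains the vector `u = (w₁ ; w₂)` — so EVERY vector of `K⁴` is in the image
  of a rank-two slice (`SW_outer`, `SW_outer_mulVec`);
* the `ξ`-slices of `⟨2,2,2⟩` are `T(ξ) = X(ξ) ⊗ 1₂`, and a limit of rank-`≤ 2` matrices of the
  form `T(ξ') + ε G` can only cover vectors `ω` with `ω₀₀ ω₁₁ = ω₀₁ ω₁₀` (rank factorisation
  through a `2 × 2` block, `rank_factor_mulVec`, evaluated at `ε = 0`).

Chaining through a degeneration `ε^h ⟨2,2,2⟩ + O(ε^{h+1}) = (A ⊗ B ⊗ C)·𝔖^ᵀ` (`L(ξ) = A S(y(ξ)) Cᵀ`,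
adjugates of `A, Bᵀ, Cᵀ` to pull back the target slice and the covering vector, `ε`-adic
normalisation of the weight vector) and choosing `ω` generic (`MvPolynomial.funext`, this is where
`Infinite K` enters) gives the contradiction (`twistedStar_not_algDegeneratesTo_matMul`). With
the rigidity theorem: `𝔖^ᵀ` and `⟨2,2,2⟩` are degeneration-incomparable although they have the
same support rank, the same slice determinants and the same quantum functionals
(`twistedStar_matMul_degeneration_incomparable`).

References: P. Bürgisser, M. Clausen, M. A. Shokrollahi, *Algebraic Complexity Theory* (1997),
(15.19), §20.2 [BurgisserClausenShokrollahi1997]; V. Strassen, J. reine angew. Math. 375/376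
(1987), §4 [Strassen1987].
-/

noncomputable section

open scoped BigOperators Polynomial Matrix

set_option linter.dupNamespace false

namespace Summit.MatrixMultiplication.MatrixMultiplication.Theorems.FarEdgeDescentTwistImage

open Literature.Computability.AlgebraicComplexity
open Summit.MatrixMultiplication.MatrixMultiplication.Theorems.FarEdgeDescentTwistedStar
open Summit.MatrixMultiplication.MatrixMultiplication.Theorems.FarEdgeDescentTwistRigidity

universe u

variable (K : Type u) [Field K]

/-- A leaf index of `𝔖_2(1)`. [folklore] -/
abbrev Leaf := Fin 2 × Fin 1
/-- First = third index type of `𝔖_2(1)`. [folklore] -/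
abbrev Idx := Leaf ⊕ Leaf
/-- First = third index type of `⟨2,2,2⟩` (`Fin 2 × Fin (1 + 1)`, written with `Fin 2`). [folklore] -/
abbrev Idx' := Fin 2 × Fin 2
/-- The middle index type. [folklore] -/
abbrev Mid := Fin 2 × Fin 2

/-- The transpose twist `𝔖^ᵀ = 𝔖_{(i,j) ↦ (j,i)}` (`= twistedStar K 2 1`). [folklore] -/
abbrev sT : Idx → Mid → Idx → K := permStar K 2 1 (Equiv.prodComm (Fin 2) (Fin 2))
/-- `⟨2,2,2⟩` (definitionally `matMulTensor K 2 2 (1 + 1)`). [folklore] -/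
abbrev tMM : Idx' → Mid → Idx' → K := matMulTensor K 2 2 2

variable {K}

/-! ## The two slice spaces -/

/-- The rank-one middle vector `Y = w₁ w₂ᵀ`. [folklore] -/
def outer (w₁ w₂ : Fin 2 → K[X]) : Mid → K[X] := fun b => w₁ b.1 * w₂ b.2

/-- The covered vector `u = (w₁ ; w₂)`. [folklore] -/
def uvec (w₁ w₂ : Fin 2 → K[X]) : Idx → K[X] := Sum.elim (fun a => w₁ a.1) (fun a => w₂ a.1)

/-- Left factor of `S(w₁ w₂ᵀ) = P Qᵀ`. [folklore] -/
def Pfac (w₁ w₂ : Fin 2 → K[X]) : Matrix Idx (Fin 2) K[X] :=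
  Matrix.of (Sum.elim (fun a k => if k = 0 then w₁ a.1 else 0) (fun a k => if k = 1 then w₂ a.1 else 0))

/-- Right factor of `S(w₁ w₂ᵀ) = P Qᵀ`. [folklore] -/
def Qfac (w₁ w₂ : Fin 2 → K[X]) : Matrix Idx (Fin 2) K[X] :=
  Matrix.of (Sum.elim (fun c k => if k = 0 then w₂ c.1 else 0) (fun c k => if k = 1 then w₁ c.1 else 0))

/-- A preimage of `(w₁ 0 · w₂ 0) u` under `S(w₁ w₂ᵀ)`. [folklore] -/
def v0 (w₁ w₂ : Fin 2 → K[X]) : Idx → K[X] :=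
  Sum.elim (fun c => if c.1 = 0 then w₁ 0 else 0) (fun c => if c.1 = 0 then w₂ 0 else 0)

/-- **The `𝔖^ᵀ`-slice of a rank-one `Y` has rank two**: `S(w₁ w₂ᵀ) = P Qᵀ`. [folklore] -/
theorem SW_outer (w₁ w₂ : Fin 2 → K[X]) :
    SW (sT K) (outer w₁ w₂) = Pfac w₁ w₂ * (Qfac w₁ w₂)ᵀ := by
  ext x x' : 1
  simp only [SW, Matrix.of_apply, Matrix.mul_apply, Matrix.transpose_apply, Fin.sum_univ_two,
    Fintype.sum_prod_type]
  rcases x with ⟨i, l⟩ | ⟨i, l⟩ <;> rcases x' with ⟨j, l'⟩ | ⟨j, l'⟩ <;>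
    obtain rfl : l = 0 := Subsingleton.elim _ _ <;> obtain rfl : l' = 0 := Subsingleton.elim _ _ <;>
    fin_cases i <;> fin_cases j <;> simp [Pfac, Qfac, outer, matMulTensor] <;> ring

/-- **… and its image contains `u`**: `S(w₁ w₂ᵀ) v₀ = (w₁ 0 · w₂ 0) u`. [folklore] -/
theorem SW_outer_mulVec (w₁ w₂ : Fin 2 → K[X]) :
    SW (sT K) (outer w₁ w₂) *ᵥ v0 w₁ w₂ = (w₁ 0 * w₂ 0) • uvec w₁ w₂ := by
  funext x
  simp only [Matrix.mulVec, dotProduct, Fintype.sum_sum_type, Fintype.sum_prod_type,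
    Fin.sum_univ_two, Fin.sum_univ_one, Pi.smul_apply, smul_eq_mul, SW, Matrix.of_apply]
  rcases x with ⟨i, l⟩ | ⟨i, l⟩ <;> obtain rfl : l = 0 := Subsingleton.elim _ _ <;>
    fin_cases i <;> simp [outer, v0, uvec, matMulTensor] <;> ring

/-- **The `⟨2,2,2⟩`-slices are `X(ξ) ⊗ 1₂`.** [folklore] -/
theorem TW_tMM_apply (ξ : Mid → K[X]) (i j : Fin 2) (k k' : Fin 2) :
    TW (tMM K) ξ (i, k) (j, k') = if k = k' then ξ (i, j) else 0 := by
  simp only [TW, Matrix.of_apply, Fintype.sum_prod_type, Fin.sum_univ_two, matMulTensor]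
  fin_cases i <;> fin_cases j <;> fin_cases k <;> fin_cases k' <;> simp

/-! ## Non-degeneracy of the three matrices of a degeneration -/

/-- `det A' ≠ 0` and `det C' ≠ 0` for the square reindexings of `A, C` (slice at `ξ = vec 1₂`:
`det L = ε^{4h} det(1 + ε G) ≠ 0`). [cite: BurgisserClausenShokrollahi1997, (15.19)] -/
theorem det_AC_ne_zero {h : ℕ} {A : Idx' → Idx → K[X]} {B : Mid → Mid → K[X]}
    {C : Idx' → Idx → K[X]} (hd : IsApproxRestriction h (sT K) (tMM K) A B C) (e : Idx' ≃ Idx) :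
    ((Matrix.of A).submatrix id e).det ≠ 0 ∧ ((Matrix.of C).submatrix id e).det ≠ 0 := by
  classical
  obtain ⟨G, hG⟩ := LW_eq_smul hd (fun b => if b.1 = b.2 then 1 else 0)
  have hT : TW (tMM K) (fun b : Mid => if b.1 = b.2 then (1 : K[X]) else 0) = 1 := by
    ext x x' : 1
    obtain ⟨i, k⟩ := x
    obtain ⟨j, k'⟩ := x'
    rw [TW_tMM_apply, Matrix.one_apply]
    fin_cases i <;> fin_cases j <;> fin_cases k <;> fin_cases k' <;> simp
  have hdet := det_LW e (sT K) A B C (fun b => if b.1 = b.2 then 1 else 0)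
  rw [hG, hT] at hdet
  have hne : (((Polynomial.X : K[X]) ^ h) •
      ((1 : Matrix Idx' Idx' K[X]) + (Polynomial.X : K[X]) • G)).det ≠ 0 := by
    rw [Matrix.det_smul]
    refine mul_ne_zero (pow_ne_zero _ (pow_ne_zero _ Polynomial.X_ne_zero)) ?_
    intro h0
    have h1 := congrArg (Polynomial.eval 0) h0
    rw [← Polynomial.coe_evalRingHom, RingHom.map_det, map_zero] at h1
    have h2 : (Polynomial.evalRingHom 0).mapMatrix
        ((1 : Matrix Idx' Idx' K[X]) + (Polynomial.X : K[X]) • G) = 1 := by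
      ext x x' : 1
      simp [Matrix.one_apply, apply_ite (Polynomial.eval (0 : K))]
    rw [h2, Matrix.det_one] at h1
    exact one_ne_zero h1
  rw [hdet] at hne
  exact ⟨(mul_ne_zero_iff.mp (mul_ne_zero_iff.mp hne).1).1, (mul_ne_zero_iff.mp hne).2⟩

/-- `det B ≠ 0`: a kernel vector `ξ` of `Bᵀ`, `ε`-adically normalised, would give
`T(ξ') + ε G = 0` with `ξ'(0) ≠ 0`. [cite: BurgisserClausenShokrollahi1997, (15.19)] -/
theorem det_B_ne_zero {h : ℕ} {A : Idx' → Idx → K[X]} {B : Mid → Mid → K[X]}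
    {C : Idx' → Idx → K[X]} (hd : IsApproxRestriction h (sT K) (tMM K) A B C) :
    (Matrix.of B).det ≠ 0 := by
  classical
  intro h0
  obtain ⟨ξ, hξ, hBξ⟩ := Matrix.exists_mulVec_eq_zero_iff.mpr
    (show ((Matrix.of B)ᵀ).det = 0 by rw [Matrix.det_transpose, h0])
  obtain ⟨m, ξ', hξ', b₀, hb₀⟩ := exists_normalize ξ hξ
  obtain ⟨p, q⟩ := b₀
  have hy : yW B ξ' = 0 := by
    have h1 : ((Polynomial.X : K[X]) ^ m) • yW B ξ' = 0 := by
      rw [← yW_smul, ← hξ', yW_mulVec, hBξ]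
    exact (smul_eq_zero.mp h1).resolve_left (pow_ne_zero _ Polynomial.X_ne_zero)
  obtain ⟨G, hG⟩ := LW_eq_smul hd ξ'
  have hL : LW (sT K) A B C ξ' = 0 := by
    rw [LW_eq_mul, hy, SW_zero, Matrix.mul_zero, Matrix.zero_mul]
  rw [hL] at hG
  have hM : TW (tMM K) ξ' + (Polynomial.X : K[X]) • G = 0 :=
    ((smul_eq_zero.mp hG.symm).resolve_left (pow_ne_zero _ Polynomial.X_ne_zero))
  have h1 := congr_fun (congr_fun hM (p, 0)) (q, 0)
  rw [Matrix.add_apply, TW_tMM_apply, if_pos rfl, Matrix.smul_apply, smul_eq_mul,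
    Matrix.zero_apply] at h1
  have h2 := congrArg (Polynomial.coeff · 0) h1
  simp only [Polynomial.coeff_add, Polynomial.coeff_X_mul_zero, add_zero,
    Polynomial.coeff_zero] at h2
  exact hb₀ h2

/-! ## A generic target vector -/

/-- **Genericity** (`K` infinite): there is `ω ∈ K^{Idx'}` with `ω₀₀ ω₁₁ ≠ ω₀₁ ω₁₀` and with two
prescribed coordinates of `adj(N) ω` nonzero (`det N ≠ 0`). [folklore] -/
theorem exists_generic [Infinite K] (N : Matrix Idx' Idx' K[X]) (hN : N.det ≠ 0) (a₁ a₂ : Idx') :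
    ∃ ω : Idx' → K, ω (0, 0) * ω (1, 1) - ω (0, 1) * ω (1, 0) ≠ 0 ∧
      (N.adjugate *ᵥ fun a => Polynomial.C (ω a)) a₁ ≠ 0 ∧
      (N.adjugate *ᵥ fun a => Polynomial.C (ω a)) a₂ ≠ 0 := by
  classical
  have hrow : ∀ a₀ : Idx', ∃ a k, (N.adjugate a₀ a).coeff k ≠ 0 := by
    intro a₀
    by_contra hcon
    have hz : ∀ a, N.adjugate a₀ a = 0 := fun a => Polynomial.ext fun k => by
      rw [Polynomial.coeff_zero]
      by_contra hk
      exact hcon ⟨a, k, hk⟩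
    have h0 := Matrix.det_eq_zero_of_row_eq_zero a₀ hz
    rw [Matrix.det_adjugate] at h0
    exact pow_ne_zero _ hN h0
  let lin : Idx' → ℕ → MvPolynomial Idx' K := fun a₀ k =>
    ∑ a, MvPolynomial.C ((N.adjugate a₀ a).coeff k) * MvPolynomial.X a
  have hlin_eval : ∀ a₀ k (ω : Idx' → K), MvPolynomial.eval ω (lin a₀ k) =
      ((N.adjugate *ᵥ fun a => Polynomial.C (ω a)) a₀).coeff k := by
    intro a₀ k ω
    simp only [lin, map_sum, map_mul, MvPolynomial.eval_C, MvPolynomial.eval_X, Matrix.mulVec,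
      dotProduct, Polynomial.finsetSum_coeff, Polynomial.coeff_mul_C]
  have hlin_ne : ∀ a₀, ∃ k, lin a₀ k ≠ 0 := by
    intro a₀
    obtain ⟨a, k, hak⟩ := hrow a₀
    refine ⟨k, fun h0 => hak ?_⟩
    have h1 := congrArg (MvPolynomial.eval (Pi.single a 1 : Idx' → K)) h0
    rw [map_zero] at h1
    simpa [lin, MvPolynomial.eval_X, Pi.single_apply] using h1
  let D : MvPolynomial Idx' K :=
    MvPolynomial.X (0, 0) * MvPolynomial.X (1, 1) - MvPolynomial.X (0, 1) * MvPolynomial.X (1, 0)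
  have hD_eval : ∀ ω : Idx' → K,
      MvPolynomial.eval ω D = ω (0, 0) * ω (1, 1) - ω (0, 1) * ω (1, 0) := by
    intro ω
    simp [D]
  have hD : D ≠ 0 := by
    intro h0
    have h1 := hD_eval (fun a => if a.1.val = a.2.val then 1 else 0)
    rw [h0, map_zero] at h1
    simp at h1
  obtain ⟨k₁, hk₁⟩ := hlin_ne a₁
  obtain ⟨k₂, hk₂⟩ := hlin_ne a₂
  have hP : lin a₁ k₁ * lin a₂ k₂ * D ≠ 0 := mul_ne_zero (mul_ne_zero hk₁ hk₂) hD
  obtain ⟨ω, hω⟩ : ∃ ω : Idx' → K, MvPolynomial.eval ω (lin a₁ k₁ * lin a₂ k₂ * D) ≠ 0 := by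
    by_contra hcon
    refine hP (MvPolynomial.funext fun ω => ?_)
    rw [map_zero]
    by_contra hne
    exact hcon ⟨ω, hne⟩
  rw [map_mul, map_mul] at hω
  have h1 := (mul_ne_zero_iff.mp (mul_ne_zero_iff.mp hω).1).1
  have h2 := (mul_ne_zero_iff.mp (mul_ne_zero_iff.mp hω).1).2
  have h3 := (mul_ne_zero_iff.mp hω).2
  rw [hD_eval] at h3
  refine ⟨ω, h3, fun h0 => h1 ?_, fun h0 => h2 ?_⟩
  · rw [hlin_eval, h0, Polynomial.coeff_zero]
  · rw [hlin_eval, h0, Polynomial.coeff_zero]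

/-! ## The theorem -/

/-- **`𝔖^ᵀ ⋭ ⟨2,2,2⟩`** (single copy, `K` infinite): the image class of the rank-two slices of `𝔖^ᵀ`
(all of `K⁴`) does not fit into the closure of the image class of the rank-`≤ 2` elements of
`T(ξ') + ε G` (vectors `ω` with `ω₀₀ ω₁₁ = ω₀₁ ω₁₀`). [cite: BurgisserClausenShokrollahi1997, (15.19), sec. 20.2] -/
theorem permStarT_not_algDegeneratesTo_matMul [Infinite K] :
    ¬ AlgDegeneratesTo (sT K) (tMM K) := by
  classical
  rintro ⟨h, A, B, C, hd⟩
  obtain ⟨e⟩ : Nonempty (Idx' ≃ Idx) := ⟨Fintype.equivOfCardEq (by simp)⟩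
  set A' : Matrix Idx' Idx' K[X] := (Matrix.of A).submatrix id e with hA'
  set C' : Matrix Idx' Idx' K[X] := (Matrix.of C).submatrix id e with hC'
  obtain ⟨hA, hC⟩ := det_AC_ne_zero hd e
  have hB := det_B_ne_zero hd
  -- a generic target vector `ω` and its pull-back `u = (w₁ ; w₂)` through `A`
  obtain ⟨ω, hω, hw₁, hw₂⟩ :=
    exists_generic A' hA (e.symm (Sum.inl (0, 0))) (e.symm (Sum.inr (0, 0)))
  set ωC : Idx' → K[X] := fun a => Polynomial.C (ω a) with hωC
  set z : Idx' → K[X] := A'.adjugate *ᵥ ωC with hz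
  set w₁ : Fin 2 → K[X] := fun i => z (e.symm (Sum.inl (i, 0))) with hw₁def
  set w₂ : Fin 2 → K[X] := fun j => z (e.symm (Sum.inr (j, 0))) with hw₂def
  have hd₀ : w₁ 0 * w₂ 0 ≠ 0 := mul_ne_zero hw₁ hw₂
  have hu : uvec w₁ w₂ = z ∘ e.symm := by
    funext x
    rcases x with ⟨i, l⟩ | ⟨i, l⟩ <;> obtain rfl : l = 0 := Subsingleton.elim _ _ <;> rfl
  have hAu : Matrix.of A *ᵥ uvec w₁ w₂ = A'.det • ωC := by
    have h1 : Matrix.of A *ᵥ uvec w₁ w₂ = A' *ᵥ z := by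
      funext a'
      simp only [Matrix.mulVec, dotProduct, hu, Function.comp_apply, hA', Matrix.submatrix_apply,
        id_eq, Matrix.of_apply]
      exact Fintype.sum_equiv e.symm _ _ fun a => by simp only [Equiv.apply_symm_apply]
    rw [h1, hz, Matrix.mulVec_mulVec, Matrix.mul_adjugate, Matrix.smul_mulVec, Matrix.one_mulVec]
  -- the target middle vector `Y = w₁ w₂ᵀ` and its pull-back `ξ` through `Bᵀ`, normalised
  set ξ : Mid → K[X] := ((Matrix.of B)ᵀ).adjugate *ᵥ outer w₁ w₂ with hξdef
  have hyξ : yW B ξ = (Matrix.of B).det • outer w₁ w₂ := by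
    rw [yW_mulVec, hξdef, Matrix.mulVec_mulVec, Matrix.mul_adjugate, Matrix.smul_mulVec,
      Matrix.one_mulVec, Matrix.det_transpose]
  have hξ0 : ξ ≠ 0 := by
    intro h0
    have h1 := congr_fun hyξ (0, 0)
    rw [h0] at h1
    simp only [yW, mul_zero, Finset.sum_const_zero, Pi.zero_apply, Pi.smul_apply, smul_eq_mul,
      outer] at h1
    exact mul_ne_zero hB hd₀ h1.symm
  obtain ⟨m, ξ', hξ', b₀, hb₀⟩ := exists_normalize ξ hξ0
  obtain ⟨p, q⟩ := b₀
  obtain ⟨G, hG⟩ := LW_eq_smul hd ξ'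
  set M : Matrix Idx' Idx' K[X] := TW (tMM K) ξ' + (Polynomial.X : K[X]) • G with hMdef
  -- the scaled slice `ε^(m+h) M = A (det B · S(Y)) Cᵀ` and its rank-two factorisation
  have hXM : ((Polynomial.X : K[X]) ^ (m + h)) • M =
      Matrix.of A * ((Matrix.of B).det • SW (sT K) (outer w₁ w₂)) * (Matrix.of C)ᵀ := by
    rw [← SW_smul, ← hyξ, ← LW_eq_mul, hξ', LW_smul, hG, smul_smul, ← pow_add]
  have hF : ((Polynomial.X : K[X]) ^ (m + h)) • M =
      ((Matrix.of B).det • (Matrix.of A * Pfac w₁ w₂)) * (Matrix.of C * Qfac w₁ w₂)ᵀ := by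
    rw [hXM, SW_outer, Matrix.transpose_mul]
    simp only [Matrix.mul_smul, Matrix.smul_mul, Matrix.mul_assoc]
  have hmin : ∀ r c : Fin 3 → Idx',
      ((((Polynomial.X : K[X]) ^ (m + h)) • M).submatrix r c).det = 0 := by
    intro r c
    rw [hF, Matrix.smul_mul, Matrix.submatrix_smul, Pi.smul_apply, Pi.smul_apply, Matrix.det_smul,
      det_submatrix_mul_transpose, mul_zero]
  -- the covering vector `v` (pull-back of `v₀` through `Cᵀ`) with `ε^(m+h) M v = D ω`
  set v : Idx' → K[X] := (C'ᵀ).adjugate *ᵥ (v0 w₁ w₂ ∘ e) with hvdef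
  have hCv : (Matrix.of C)ᵀ *ᵥ v = C'.det • v0 w₁ w₂ := by
    have h1 : ∀ j, ((Matrix.of C)ᵀ *ᵥ v) (e j) = (C'ᵀ *ᵥ v) j := by
      intro j
      simp only [Matrix.mulVec, dotProduct, Matrix.transpose_apply, Matrix.of_apply, hC',
        Matrix.submatrix_apply, id_eq]
    funext a
    obtain ⟨j, rfl⟩ := e.surjective a
    rw [h1, hvdef, Matrix.mulVec_mulVec, Matrix.mul_adjugate, Matrix.smul_mulVec,
      Matrix.one_mulVec, Matrix.det_transpose]
    rfl
  set D : K[X] := C'.det * (Matrix.of B).det * (w₁ 0 * w₂ 0) * A'.det with hD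
  have hD0 : D ≠ 0 := mul_ne_zero (mul_ne_zero (mul_ne_zero hC hB) hd₀) hA
  have hV : (((Polynomial.X : K[X]) ^ (m + h)) • M) *ᵥ v = D • ωC := by
    rw [hXM, ← Matrix.mulVec_mulVec, ← Matrix.mulVec_mulVec, hCv]
    simp only [Matrix.mulVec_smul, Matrix.smul_mulVec, SW_outer_mulVec, hAu, smul_smul, hD,
      mul_assoc]
  -- rank factorisation through the `2 × 2` block at `(p, q)`, where `ξ'(0)_{pq} ≠ 0`
  set ρ : Fin 2 → Idx' := fun k => (p, k) with hρ
  set γ : Fin 2 → Idx' := fun k => (q, k) with hγ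
  set N : Matrix (Fin 2) (Fin 2) K[X] := M.submatrix ρ γ with hN
  have hsub : (((Polynomial.X : K[X]) ^ (m + h)) • M).submatrix ρ γ =
      ((Polynomial.X : K[X]) ^ (m + h)) • N := by
    rw [hN, Matrix.submatrix_smul]
    rfl
  have key : ∀ r, N.det * ωC r = ∑ k, ∑ l, M r (γ k) * N.adjugate k l * ωC (ρ l) := by
    intro r
    have h1 := rank_factor_mulVec _ hmin ρ γ v r
    rw [hsub, Matrix.det_smul, Matrix.adjugate_smul, hV] at h1
    simp only [Fintype.card_fin, show (2 : ℕ) - 1 = 1 from rfl, pow_one, Matrix.smul_apply,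
      Pi.smul_apply, smul_eq_mul, Fin.sum_univ_two] at h1 ⊢
    have h2 : (((Polynomial.X : K[X]) ^ (m + h)) ^ 2 * D) *
        (N.det * ωC r - (M r (γ 0) * N.adjugate 0 0 * ωC (ρ 0) +
          M r (γ 0) * N.adjugate 0 1 * ωC (ρ 1) +
          (M r (γ 1) * N.adjugate 1 0 * ωC (ρ 0) + M r (γ 1) * N.adjugate 1 1 * ωC (ρ 1)))) =
        0 := by
      linear_combination h1
    exact sub_eq_zero.mp ((mul_eq_zero.mp h2).resolve_left
      (mul_ne_zero (pow_ne_zero _ (pow_ne_zero _ Polynomial.X_ne_zero)) hD0))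
  -- evaluation at `ε = 0`
  set ξ₀ : Mid → K := fun b => (ξ' b).coeff 0 with hξ₀
  have hM0 : ∀ (i j : Fin 2) (k k' : Fin 2),
      Polynomial.eval 0 (M (i, k) (j, k')) = if k = k' then ξ₀ (i, j) else 0 := by
    intro i j k k'
    rw [← Polynomial.coeff_zero_eq_eval_zero, hMdef, Matrix.add_apply, TW_tMM_apply,
      Matrix.smul_apply, smul_eq_mul, Polynomial.coeff_add, Polynomial.coeff_X_mul_zero, add_zero]
    by_cases hk : k = k'
    · rw [if_pos hk, if_pos hk]
    · rw [if_neg hk, if_neg hk, Polynomial.coeff_zero]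
  have hδ : Polynomial.eval 0 N.det = ξ₀ (p, q) ^ 2 := by
    rw [← Polynomial.coe_evalRingHom, RingHom.map_det]
    have h1 : (Polynomial.evalRingHom (0 : K)).mapMatrix N = !![ξ₀ (p, q), 0; 0, ξ₀ (p, q)] := by
      ext k l : 1
      rw [RingHom.mapMatrix_apply, Matrix.map_apply, Polynomial.coe_evalRingHom, hN,
        Matrix.submatrix_apply, hρ, hγ, hM0]
      fin_cases k <;> fin_cases l <;> simp
    rw [h1, Matrix.det_fin_two_of]
    ring
  set β : Fin 2 → K := fun k' => ∑ l, Polynomial.eval 0 (N.adjugate k' l) * ω (p, l)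
    with hβ
  have eq1 : ∀ (i : Fin 2) (k' : Fin 2), ξ₀ (p, q) ^ 2 * ω (i, k') = ξ₀ (i, q) * β k' := by
    intro i k'
    have h1 := congrArg (Polynomial.eval (0 : K)) (key (i, k'))
    simp only [Polynomial.eval_mul, Polynomial.eval_finsetSum, hωC, Polynomial.eval_C, hδ, hρ,
      hγ, hM0] at h1
    rw [h1, hβ]
    simp only [Fin.sum_univ_two]
    fin_cases k' <;> simp <;> ring
  have hfin : (ξ₀ (p, q) ^ 2) ^ 2 * (ω (0, 0) * ω (1, 1) - ω (0, 1) * ω (1, 0)) = 0 := by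
    have e00 := eq1 0 0
    have e11 := eq1 1 1
    have e01 := eq1 0 1
    have e10 := eq1 1 0
    linear_combination (ξ₀ (p, q) ^ 2 * ω (1, 1)) * e00 + (ξ₀ (0, q) * β 0) * e11 -
      (ξ₀ (p, q) ^ 2 * ω (1, 0)) * e01 - (ξ₀ (0, q) * β 1) * e10
  exact hω ((mul_eq_zero.mp hfin).resolve_left (pow_ne_zero _ (pow_ne_zero _ hb₀)))

variable (K)

/-- **`𝔖_2(1) ⋭ ⟨2,2,2⟩`** over every infinite field. [cite: BurgisserClausenShokrollahi1997, (15.19), sec. 20.2] -/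
theorem twistedStar_not_algDegeneratesTo_matMul [Infinite K] :
    ¬ AlgDegeneratesTo (twistedStar K 2 1) (matMulTensor K 2 2 (1 + 1)) := by
  rw [← permStar_prodComm]
  exact permStarT_not_algDegeneratesTo_matMul

/-- **Degeneration-incomparability of `𝔖^ᵀ` and `⟨2,2,2⟩`** (infinite field, single copy): the
generic twist class `ᵀ` is neither above (image class, this file) nor below (commutant rigidity,
`FarEdgeDescentTwistRigidity`) the coherent star. [cite: BurgisserClausenShokrollahi1997, (15.19), sec. 20.2; Strassen1987, sec. 4] -/
theorem twistedStar_matMul_degeneration_incomparable [Infinite K] :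
    ¬ AlgDegeneratesTo (twistedStar K 2 1) (matMulTensor K 2 2 (1 + 1)) ∧
      ¬ AlgDegeneratesTo (matMulTensor K 2 2 (1 + 1)) (twistedStar K 2 1) := by
  refine ⟨twistedStar_not_algDegeneratesTo_matMul K, fun hd => ?_⟩
  rw [← permStar_prodComm] at hd
  exact not_isProdPerm_prodComm le_rfl ((matMul_algDegeneratesTo_permStar_one_iff _).mp hd)

end Summit.MatrixMultiplication.MatrixMultiplication.Theorems.FarEdgeDescentTwistImage

end
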